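import Summits.QuantumFields.YangMills.Theorems.FluctuationComparisonRegPrIntLOrganTangentSquareStability
import Summits.QuantumFields.YangMills.Theorems.FluctuationComparisonRegPrIntLOrganTangentFibreWeightSquareIntegrability
import Summits.QuantumFields.YangMills.Theorems.FluctuationComparisonRegPrIntLOrganTangentSecondDiffIntegration
import HarnessLib

/-!
# Crux `FluctuationComparisonRegPrIntL` (stmt-QuantumFields-20520, rung R3), PATH-B organ — «JT-E2E»: THE (JT-h) BRACKET OF THE FROZEN ROW AT ONE SQUARE,
# THEOREMS-SIDE, FROM {square stability letters `DP, Dw`, the curvature square clause of `h_Ts∘Φ` on the good set, a crude clause + tail} (DEFINITION-FREE)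

Cell `ym3-torus` (YM ladder rung R3 = continuum `SU(2)` Yang–Mills on the three-torus — a RUNG: NOT d = 4, NOT infinite volume, NOT a mass gap, NOT Clay).
Width seat `ym3-torus-px19` (gen 20); LEAD w3 g26 №24 (1) GO «JT-E2E» (DISCHARGE SPEC v1.0∕v1.3 §6 step 3, crux workfile `DISCHARGE-SPEC-SpreadFibreLawHJ-w3g26.md`);
`--kind proof --supports stmt-QuantumFields-20520 --as helper`, count-neutral, no registry ∕ binder ∕ `Lines/` edit, default heartbeats, `autoImplicit false`.

WHAT.  For ONE stride `(j, Ts)` of the organ frame, ONE real `t`, ONE admissible coarse square `(U V W Y; B m; B′ m′)` and ONE law point `Xw` (all `PlaqSmall (θBal_j∕4)`, sizes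
`≤ rc·θBal_j∕4`, the frozen relational corner hypotheses), ★★★`jtBracket_of_curvatureTransport` concludes THE (JT-h) CONJUNCT TEXT of `SpreadFibreLawH` [12] (i) (✓p812742,
body 833268b9, character-for-character up to the letter's name):
`Integrable (F_U·ŵ) ∧ Integrable (F_V·ŵ) ∧ Integrable (F_W·ŵ) ∧ Integrable (F_Y·ŵ) ∧ |∫ (F_Y − F_V − F_W + F_U)·ŵ dτ| ≤ (kG + ES·kB)·(‖m‖∕(θ_j∕4))·(‖m′‖∕(θ_j∕4))`
(`F_X z := log ρ_Ts(Φ(X,z)) − log ρ′_Ts(Φ(X,z))`, `ŵ := wgt … t Xw`), FROM EXACTLY: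
* (α) the FRAME∕CHART facts ✓`wgt_normalised` (✓p814778) and ✓`integrable_logRatio_mul_wgt_of_squareStability` (✓p815882) consume: `ρ_Ts, ρ′_Ts` measurable, continuous and positive
  on the `θ_Ts`-window, the four `mwCut` facts, `τ` a probability, `Φ, J` measurable, `J ≤ CJ`, positive good-set mass [9];
* (β) D1 SQUARE STABILITY (✓p815965 v1.1 `plaqSmall_chart_along_square_of_lawPoint`): the one-bond plaquette DISPLACEMENT clause `DP` of the chart `Φ(·,z)` on the `θ_j`-window
  (z-uniform letters, caps `Db, Db′` at the two moved bonds) and the WINDOW-TO-WINDOW letter `Dw`, with room `24∕25·θ_Ts + Dw + (Db + Db′)·rc ≤ c·θ_Ts`, `c < 1`, `√3·rc ≤ 3∕4`;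
* (γ) D2 the DIFFERENTIAL CURVATURE SQUARE CLAUSE (shape (s2), ✓p814806's hypothesis VERBATIM) of `RT_z := h_Ts∘Φ(·,z)` for every `z` of a measurable GOOD set with
  `ŵ z ≠ 0`, z-UNIFORM letters `k̃ g̃ KP KP2` ⟹ good letter `kG := Σ_{p q} KP p B·k̃ p q·KP q B′ + Σ_p g̃ p·KP2 p B B′` (row mass ✓`rowMass_curvLetters`);
* (δ) a CRUDE pointwise letter `kB ≥ 0` on `{ŵ ≠ 0}` and a TAIL `∫_{Goodᶜ} ŵ ≤ ES` (OPEN binders: at the top level square stability makes `Good := {ŵ ≠ 0}`, `ES := 0`, `kB := kG`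
  admissible, but a discharger with a smaller good set docks too — LEAD №24);
* (ε) ✓`abs_integral_secondDiff_mul_le_good_add_tail` + ✓`secondDiff_letter_bound` (✓p815931 JT-INT).
So, BY KERNEL: **(JT-h) at a square ⟸ {`DP`, `Dw`, the curvature square clause of `h_Ts∘Φ` on the good set, (`kB`, `ES`)} + frame facts** — DISCHARGE SPEC §6 step 3 as a
theorem; the remaining inputs are PRINT ([Balaban1985Variational] Thm 1 (9)–(10), Prop 9 (190); [Balaban1987RG1] (0.22)–(0.25)) and are NOT constructed here.
§1 `wNum_interp_nonneg`∕`wgt_interp_nonneg` (the interpolated weight is pointwise `≥ 0`: `mwCut ≥ 0` kills the off-window points, on-window `ρ, ρ′ > 0`), `plaqSmall_top_of_mwCut_ne_zero`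
(`mwCut(U) ≠ 0 ⟹ U ∈ PlaqSmall (24∕25·θ_Ts)`, via `hχsupp` at `n := Ts` + `descendTo_self`); §2 the theorem.

HONEST FRAMING: a composition of landed bookkeeping over HYPOTHESIS clauses; nothing of Bałaban's analysis is asserted or proved; `SpreadFibreLawH(J)`, LIN″, JEN″, JVARᵘ-H″,
O1ᵘ-H v2.2, S1aᴴ, S3ᴴ, S2α′, S2β, 26243, the five registered stubs, crux 20520 `FluctuationComparisonRegPrIntL` and `YM3TorusSU2` are NOT proved; no summit ∕ sub-problem
statement is proved; registry `Lines/semiclassical_s2beta.lean` 3732b7df untouched; rung R3 = SU(2) YM₃ on T³ at fixed lattice data — NOT d = 4, NOT infinite volume, NOT a mass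
gap, NOT Clay; the Yang–Mills mass gap is NOT proved.  [folklore]
-/

set_option autoImplicit false

noncomputable section

namespace Summit.QuantumFields.YangMills.Theorems.OrganTangentJTOfCurvatureTransport

open MeasureTheory Filter Topology Function Set
open scoped ENNReal NNReal BigOperators
open Literature.MathematicalPhysics.QuantumFieldTheory.Balaban1983to89 T3ContinuumYM3Torus T3NestedUnitLaws
  T3UnitLawDensityEML T4Continuum BalabanUVClass T3UnitScaleTilt T3LevelShift T3TiltDescent
open T4CubeChartExp (expPt)
open Summit.QuantumFields.YangMills.Theorems.FluctuationComparisonRegPrIntLRunpairOrganFibreLaw (mwCut wNum wgt)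
open Summit.QuantumFields.YangMills.Theorems.OrganTangentFibreWeightNormalisation (wgt_normalised)
open Summit.QuantumFields.YangMills.Theorems.OrganTangentFibreWeightSquareIntegrability (integrable_logRatio_mul_wgt_of_squareStability)
open Summit.QuantumFields.YangMills.Theorems.OrganTangentSecondDiffIntegration (abs_integral_secondDiff_mul_le_good_add_tail secondDiff_letter_bound)
open Summit.QuantumFields.YangMills.Theorems.OrganTangentSquareStability (plaqSmall_chart_along_square_of_lawPoint)
open Summit.QuantumFields.YangMills.Theorems.OrganTangentPullbackSquareCurvOrgan (hClauseSq_of_curvSquare)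
open Summit.QuantumFields.YangMills.Theorems.OrganTangentSeedHClause (corner_fst_zero corner_zero_snd corner_zero_zero)

/-! ## §1 Two small facts about the organ's weight and cut -/

/-- The interpolated weight numerator is pointwise non-negative: off the multi-window `mwCut = 0` kills it, on it `ρ_Ts, ρ′_Ts > 0`. [folklore] -/
theorem wNum_interp_nonneg (F : T3Family) (γ b₀ p₀ : ℝ) (j Ts : ℕ)
    (ρ ρ' : (i : ℕ) → GaugeField (F.P i) 0 ↥(Matrix.specialUnitaryGroup (Fin 2) ℂ) → ℝ)
    (hρpos : ∀ U, PlaqSmall (θBal F.L γ b₀ p₀ Ts) U → 0 < ρ Ts U ∧ 0 < ρ' Ts U)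
    (hθ : 0 < θBal F.L γ b₀ p₀ Ts)
    (hχ0 : ∀ U, 0 ≤ mwCut F γ b₀ p₀ j Ts U)
    (hχsupp : ∀ U, mwCut F γ b₀ p₀ j Ts U ≠ 0 → ∀ (n : ℕ) (hjn : j + 1 ≤ n) (hnK : n ≤ Ts),
      PlaqSmall (24 / 25 * θBal F.L γ b₀ p₀ n) (descendTo F ℰp n Ts hnK U))
    (hjTs : j + 1 ≤ Ts)
    {Z : Type} (Φ : GaugeField (F.P j) 0 ↥(Matrix.specialUnitaryGroup (Fin 2) ℂ) × Z → GaugeField (F.P Ts) 0 ↥(Matrix.specialUnitaryGroup (Fin 2) ℂ))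
    (J : GaugeField (F.P j) 0 ↥(Matrix.specialUnitaryGroup (Fin 2) ℂ) × Z → ℝ≥0) (t : ℝ)
    (V : GaugeField (F.P j) 0 ↥(Matrix.specialUnitaryGroup (Fin 2) ℂ)) (z : Z) :
    0 ≤ wNum F γ b₀ p₀ j Ts ρ ρ' Φ J t V z := by
  unfold wNum
  by_cases hχ : mwCut F γ b₀ p₀ j Ts (Φ (V, z)) = 0
  · rw [hχ]; simp
  · have hW : PlaqSmall (θBal F.L γ b₀ p₀ Ts) (Φ (V, z)) := by
      have h := hχsupp (Φ (V, z)) hχ Ts hjTs le_rfl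
      rw [T3DescentFibreTower.descendTo_self] at h
      exact fun p => lt_of_lt_of_le (h p) (by nlinarith [hθ])
    have hpos := hρpos _ hW
    exact mul_nonneg (mul_nonneg (hχ0 _) (mul_nonneg (Real.rpow_nonneg hpos.1.le _) (Real.rpow_nonneg hpos.2.le _))) (NNReal.coe_nonneg _)

/-- The normalised interpolated weight `ŵ_t(V,·)` is pointwise non-negative once its numerator has positive mass. [folklore] -/
theorem wgt_interp_nonneg (F : T3Family) (γ b₀ p₀ : ℝ) (j Ts : ℕ)
    (ρ ρ' : (i : ℕ) → GaugeField (F.P i) 0 ↥(Matrix.specialUnitaryGroup (Fin 2) ℂ) → ℝ)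
    (hρpos : ∀ U, PlaqSmall (θBal F.L γ b₀ p₀ Ts) U → 0 < ρ Ts U ∧ 0 < ρ' Ts U)
    (hθ : 0 < θBal F.L γ b₀ p₀ Ts)
    (hχ0 : ∀ U, 0 ≤ mwCut F γ b₀ p₀ j Ts U)
    (hχsupp : ∀ U, mwCut F γ b₀ p₀ j Ts U ≠ 0 → ∀ (n : ℕ) (hjn : j + 1 ≤ n) (hnK : n ≤ Ts),
      PlaqSmall (24 / 25 * θBal F.L γ b₀ p₀ n) (descendTo F ℰp n Ts hnK U))
    (hjTs : j + 1 ≤ Ts)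
    {Z : Type} [MeasurableSpace Z] (τ : Measure Z)
    (Φ : GaugeField (F.P j) 0 ↥(Matrix.specialUnitaryGroup (Fin 2) ℂ) × Z → GaugeField (F.P Ts) 0 ↥(Matrix.specialUnitaryGroup (Fin 2) ℂ))
    (J : GaugeField (F.P j) 0 ↥(Matrix.specialUnitaryGroup (Fin 2) ℂ) × Z → ℝ≥0) (t : ℝ)
    (V : GaugeField (F.P j) 0 ↥(Matrix.specialUnitaryGroup (Fin 2) ℂ))
    (hmass : 0 < ∫ z, wNum F γ b₀ p₀ j Ts ρ ρ' Φ J t V z ∂τ) (z : Z) :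
    0 ≤ wgt F γ b₀ p₀ j Ts ρ ρ' τ Φ J t V z := by
  unfold wgt
  exact div_nonneg (wNum_interp_nonneg F γ b₀ p₀ j Ts ρ ρ' hρpos hθ hχ0 hχsupp hjTs Φ J t V z) hmass.le

/-- `mwCut(U) ≠ 0 ⟹ U ∈ PlaqSmall (24∕25·θ_Ts)` (the top factor of the multi-window cut; `descendTo_self`). [folklore] -/
theorem plaqSmall_top_of_mwCut_ne_zero (F : T3Family) (γ b₀ p₀ : ℝ) (j Ts : ℕ) (hjTs : j + 1 ≤ Ts)
    (hχsupp : ∀ U, mwCut F γ b₀ p₀ j Ts U ≠ 0 → ∀ (n : ℕ) (hjn : j + 1 ≤ n) (hnK : n ≤ Ts),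
      PlaqSmall (24 / 25 * θBal F.L γ b₀ p₀ n) (descendTo F ℰp n Ts hnK U))
    (U : GaugeField (F.P Ts) 0 ↥(Matrix.specialUnitaryGroup (Fin 2) ℂ)) (hU : mwCut F γ b₀ p₀ j Ts U ≠ 0) :
    PlaqSmall (24 / 25 * θBal F.L γ b₀ p₀ Ts) U := by
  have h := hχsupp U hU Ts hjTs le_rfl
  rwa [T3DescentFibreTower.descendTo_self] at h

/-! ## §2 ★★★ The (JT-h) bracket at one square from square stability + the curvature square clause + (crude, tail) -/

/-- ★★★ **JT-E2E.**  THE (JT-h) CONJUNCT TEXT of the frozen row `SpreadFibreLawH` at ONE admissible square and ONE law point, for ONE real `t`, FROM: the frame∕chart facts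
(α); the square-stability letters `DP` (one-bond displacement clause of `Φ(·,z)` on the `θ_j`-window, caps `Db, Db′`) and `Dw` (window-to-window), room
`24∕25·θ_Ts + Dw + (Db + Db′)·rc ≤ c·θ_Ts`, `c < 1`, `√3·rc ≤ 3∕4` (β); the DIFFERENTIAL CURVATURE SQUARE CLAUSE of `h_Ts∘Φ(·,z)` (✓p814806's (s2) hypothesis, z-uniform
letters) on a measurable good set (γ); a crude letter `kB` on `{ŵ ≠ 0}` and a tail `ES` (δ).  Letter: `kG + ES·kB`, `kG := Σ_{p q} KP p B·k̃ p q·KP q B′ + Σ_p g̃ p·KP2 p B B′`.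
[folklore] -/
theorem jtBracket_of_curvatureTransport (F : T3Family) (γ b₀ p₀ : ℝ) (j Ts : ℕ) (hjTs : j + 1 ≤ Ts)
    (ρ ρ' : (i : ℕ) → GaugeField (F.P i) 0 ↥(Matrix.specialUnitaryGroup (Fin 2) ℂ) → ℝ)
    (hρm : Measurable (ρ Ts)) (hρ'm : Measurable (ρ' Ts))
    (hρc : ContinuousOn (ρ Ts) {U | PlaqSmall (θBal F.L γ b₀ p₀ Ts) U}) (hρ'c : ContinuousOn (ρ' Ts) {U | PlaqSmall (θBal F.L γ b₀ p₀ Ts) U})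
    (hρpos : ∀ U, PlaqSmall (θBal F.L γ b₀ p₀ Ts) U → 0 < ρ Ts U ∧ 0 < ρ' Ts U)
    (hθ : 0 < θBal F.L γ b₀ p₀ Ts) (hθj : 0 < θBal F.L γ b₀ p₀ j)
    (hχc : Continuous (mwCut F γ b₀ p₀ j Ts)) (hχ0 : ∀ U, 0 ≤ mwCut F γ b₀ p₀ j Ts U)
    (hχsupp : ∀ U, mwCut F γ b₀ p₀ j Ts U ≠ 0 → ∀ (n : ℕ) (hjn : j + 1 ≤ n) (hnK : n ≤ Ts), PlaqSmall (24 / 25 * θBal F.L γ b₀ p₀ n) (descendTo F ℰp n Ts hnK U))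
    (hχpos : ∀ U, (∀ (n : ℕ) (hjn : j + 1 ≤ n) (hnK : n ≤ Ts), PlaqSmall (24 / 25 * θBal F.L γ b₀ p₀ n) (descendTo F ℰp n Ts hnK U)) → 0 < mwCut F γ b₀ p₀ j Ts U)
    {Z : Type} [MeasurableSpace Z] (τ : Measure Z) [IsProbabilityMeasure τ]
    (Φ : GaugeField (F.P j) 0 ↥(Matrix.specialUnitaryGroup (Fin 2) ℂ) × Z → GaugeField (F.P Ts) 0 ↥(Matrix.specialUnitaryGroup (Fin 2) ℂ))
    (J : GaugeField (F.P j) 0 ↥(Matrix.specialUnitaryGroup (Fin 2) ℂ) × Z → ℝ≥0)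
    (hΦm : Measurable Φ) (hJm : Measurable J) (CJ : ℝ) (hJle : ∀ V z, (J (V, z) : ℝ) ≤ CJ)
    (hpos : ∀ V, PlaqSmall (θBal F.L γ b₀ p₀ j) V →
      0 < ∫⁻ z in {z | (∀ (n : ℕ) (hjn : j + 1 ≤ n) (hnK : n ≤ Ts), PlaqSmall (24 / 25 * θBal F.L γ b₀ p₀ n) (descendTo F ℰp n Ts hnK (Φ (V, z))))},
        (J (V, z) : ℝ≥0∞) ∂τ)
    (t : ℝ)
    -- (β) square stability letters of the chart (z-uniform): one-bond displacement `DP` on the `θ_j`-window, window-to-window `Dw`, room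
    {rc c Dw Db Db' : ℝ} (hrc : Real.sqrt 3 * rc ≤ 3 / 4) (hc : c < 1)
    (DP : Plaq (F.P Ts) 0 → PBond (F.P j) 0 → ℝ) (hDb0 : 0 ≤ Db) (hDb0' : 0 ≤ Db')
    (hdisp : ∀ (z : Z) (X : GaugeField (F.P j) 0 ↥(Matrix.specialUnitaryGroup (Fin 2) ℂ)), PlaqSmall (θBal F.L γ b₀ p₀ j) X →
      ∀ (b : PBond (F.P j) 0) (v : Fin 3 → ℝ), ‖v‖ ≤ rc * (θBal F.L γ b₀ p₀ j / 4) → ∀ s ∈ Icc (0 : ℝ) 1, ∀ p : Plaq (F.P Ts) 0,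
        dist1 (GaugeField.plaqHol (Φ (update X b (X b * expPt (s • v)), z)) p)
          ≤ dist1 (GaugeField.plaqHol (Φ (X, z)) p) + DP p b * (‖v‖ / (θBal F.L γ b₀ p₀ j / 4)))
    (hglob : ∀ (z : Z) (X X' : GaugeField (F.P j) 0 ↥(Matrix.specialUnitaryGroup (Fin 2) ℂ)), PlaqSmall (θBal F.L γ b₀ p₀ j / 4) X →
      PlaqSmall (θBal F.L γ b₀ p₀ j / 4) X' →
      ∀ p : Plaq (F.P Ts) 0, dist1 (GaugeField.plaqHol (Φ (X', z)) p) ≤ dist1 (GaugeField.plaqHol (Φ (X, z)) p) + Dw)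
    (hroom : 24 / 25 * θBal F.L γ b₀ p₀ Ts + Dw + (Db + Db') * rc ≤ c * θBal F.L γ b₀ p₀ Ts)
    -- the square and the law point
    (B B' : PBond (F.P j) 0) (m m' : Fin 3 → ℝ) (U V W Y Xw : GaugeField (F.P j) 0 ↥(Matrix.specialUnitaryGroup (Fin 2) ℂ))
    (hm : ‖m‖ ≤ rc * (θBal F.L γ b₀ p₀ j / 4)) (hm' : ‖m'‖ ≤ rc * (θBal F.L γ b₀ p₀ j / 4))
    (hU : PlaqSmall (θBal F.L γ b₀ p₀ j / 4) U) (hV : PlaqSmall (θBal F.L γ b₀ p₀ j / 4) V) (hW : PlaqSmall (θBal F.L γ b₀ p₀ j / 4) W)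
    (hY : PlaqSmall (θBal F.L γ b₀ p₀ j / 4) Y) (hXw : PlaqSmall (θBal F.L γ b₀ p₀ j / 4) Xw)
    (hVU : ∀ e, e ≠ B → V e = U e) (hVb : V B = U B * expPt m) (hWU : ∀ e, e ≠ B' → W e = U e) (hWb : W B' = U B' * expPt m')
    (hYV : ∀ e, e ≠ B' → Y e = V e) (hYb : Y B' = V B' * expPt m')
    (hDb : ∀ p, DP p B ≤ Db) (hDb' : ∀ p, DP p B' ≤ Db')
    -- (γ) the curvature square clause of `h_Ts ∘ Φ(·, z)` on the good set (✓p814806's (s2) hypothesis, z-uniform letters)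
    {ιP : Type*} [Fintype ιP] (kP : ιP → ιP → ℝ) (gP : ιP → ℝ) (KP : ιP → PBond (F.P j) 0 → ℝ) (KP2 : ιP → PBond (F.P j) 0 → PBond (F.P j) 0 → ℝ)
    (hk : ∀ p q, 0 ≤ kP p q) (hg : ∀ p, 0 ≤ gP p) (hKP : ∀ p b, 0 ≤ KP p b) (hKP2 : ∀ p b b', 0 ≤ KP2 p b b')
    (Good : Set Z) (hGood : MeasurableSet Good)
    (hcurv : ∀ z ∈ Good, wgt F γ b₀ p₀ j Ts ρ ρ' τ Φ J t Xw z ≠ 0 →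
      ∀ (b b' : PBond (F.P j) 0) (v v' : Fin 3 → ℝ) (X : GaugeField (F.P j) 0 ↥(Matrix.specialUnitaryGroup (Fin 2) ℂ)),
      ‖v‖ ≤ rc * (θBal F.L γ b₀ p₀ j / 4) → ‖v'‖ ≤ rc * (θBal F.L γ b₀ p₀ j / 4) → PlaqSmall (θBal F.L γ b₀ p₀ j / 4) X →
      PlaqSmall (θBal F.L γ b₀ p₀ j / 4) (update X b (X b * expPt v)) → PlaqSmall (θBal F.L γ b₀ p₀ j / 4) (update X b' (X b' * expPt v')) →
      PlaqSmall (θBal F.L γ b₀ p₀ j / 4) (update (update X b (X b * expPt v)) b' ((update X b (X b * expPt v)) b' * expPt v')) →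
      ∃ (F₂ F₁₂ : ℝ → ℝ → ℝ) (α α' γ' : ιP → ℝ → ℝ → ℝ),
        (∀ t' ∈ Icc (0 : ℝ) 1, HasDerivWithinAt
          (fun t' => (fun X' => Real.log (ρ Ts (Φ (X', z))) - Real.log (ρ' Ts (Φ (X', z))))
            (update (update X b (X b * expPt ((0 : ℝ) • v))) b' ((update X b (X b * expPt ((0 : ℝ) • v))) b' * expPt (t' • v'))))
          (F₂ 0 t') (Icc 0 1) t') ∧
        (∀ t' ∈ Icc (0 : ℝ) 1, HasDerivWithinAt
          (fun t' => (fun X' => Real.log (ρ Ts (Φ (X', z))) - Real.log (ρ' Ts (Φ (X', z))))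
            (update (update X b (X b * expPt ((1 : ℝ) • v))) b' ((update X b (X b * expPt ((1 : ℝ) • v))) b' * expPt (t' • v'))))
          (F₂ 1 t') (Icc 0 1) t') ∧
        (∀ t' ∈ Icc (0 : ℝ) 1, ∀ s ∈ Icc (0 : ℝ) 1, HasDerivWithinAt (fun s => F₂ s t') (F₁₂ s t') (Icc 0 1) s) ∧
        (∀ p, ∀ s ∈ Icc (0 : ℝ) 1, ∀ t' ∈ Icc (0 : ℝ) 1, 0 ≤ α p s t' ∧ α p s t' ≤ KP p b * (‖v‖ / (θBal F.L γ b₀ p₀ j / 4))) ∧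
        (∀ q, ∀ s ∈ Icc (0 : ℝ) 1, ∀ t' ∈ Icc (0 : ℝ) 1, 0 ≤ α' q s t' ∧ α' q s t' ≤ KP q b' * (‖v'‖ / (θBal F.L γ b₀ p₀ j / 4))) ∧
        (∀ p, ∀ s ∈ Icc (0 : ℝ) 1, ∀ t' ∈ Icc (0 : ℝ) 1,
          0 ≤ γ' p s t' ∧ γ' p s t' ≤ KP2 p b b' * (‖v‖ / (θBal F.L γ b₀ p₀ j / 4)) * (‖v'‖ / (θBal F.L γ b₀ p₀ j / 4))) ∧
        (∀ s ∈ Icc (0 : ℝ) 1, ∀ t' ∈ Icc (0 : ℝ) 1,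
          |F₁₂ s t'| ≤ ∑ p, ∑ q, α p s t' * kP p q * α' q s t' + ∑ p, gP p * γ' p s t'))
    -- (δ) crude letter on the law's support and tail of the good set
    {kB ES : ℝ} (hkB : 0 ≤ kB) (hES : 0 ≤ ES)
    (hcrude : ∀ z, wgt F γ b₀ p₀ j Ts ρ ρ' τ Φ J t Xw z ≠ 0 →
      |(Real.log (ρ Ts (Φ (Y, z))) - Real.log (ρ' Ts (Φ (Y, z)))) - (Real.log (ρ Ts (Φ (V, z))) - Real.log (ρ' Ts (Φ (V, z))))
        - (Real.log (ρ Ts (Φ (W, z))) - Real.log (ρ' Ts (Φ (W, z)))) + (Real.log (ρ Ts (Φ (U, z))) - Real.log (ρ' Ts (Φ (U, z))))|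
        ≤ kB * (‖m‖ / (θBal F.L γ b₀ p₀ j / 4)) * (‖m'‖ / (θBal F.L γ b₀ p₀ j / 4)))
    (htail : ∫ z in Goodᶜ, wgt F γ b₀ p₀ j Ts ρ ρ' τ Φ J t Xw z ∂τ ≤ ES) :
    Integrable (fun z => (Real.log (ρ Ts (Φ (U, z))) - Real.log (ρ' Ts (Φ (U, z)))) * (wgt F γ b₀ p₀ j Ts ρ ρ' τ Φ J t) Xw z) τ ∧
    Integrable (fun z => (Real.log (ρ Ts (Φ (V, z))) - Real.log (ρ' Ts (Φ (V, z)))) * (wgt F γ b₀ p₀ j Ts ρ ρ' τ Φ J t) Xw z) τ ∧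
    Integrable (fun z => (Real.log (ρ Ts (Φ (W, z))) - Real.log (ρ' Ts (Φ (W, z)))) * (wgt F γ b₀ p₀ j Ts ρ ρ' τ Φ J t) Xw z) τ ∧
    Integrable (fun z => (Real.log (ρ Ts (Φ (Y, z))) - Real.log (ρ' Ts (Φ (Y, z)))) * (wgt F γ b₀ p₀ j Ts ρ ρ' τ Φ J t) Xw z) τ ∧
    |∫ z, ((Real.log (ρ Ts (Φ (Y, z))) - Real.log (ρ' Ts (Φ (Y, z)))) - (Real.log (ρ Ts (Φ (V, z))) - Real.log (ρ' Ts (Φ (V, z))))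
      - (Real.log (ρ Ts (Φ (W, z))) - Real.log (ρ' Ts (Φ (W, z)))) + (Real.log (ρ Ts (Φ (U, z))) - Real.log (ρ' Ts (Φ (U, z)))))
        * (wgt F γ b₀ p₀ j Ts ρ ρ' τ Φ J t) Xw z ∂τ|
      ≤ ((∑ p, ∑ q, KP p B * kP p q * KP q B' + ∑ p, gP p * KP2 p B B') + ES * kB)
        * (‖m‖ / (θBal F.L γ b₀ p₀ j / 4)) * (‖m'‖ / (θBal F.L γ b₀ p₀ j / 4)) := by
  -- abbreviations
  set θc : ℝ := θBal F.L γ b₀ p₀ j / 4 with hθc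
  set ŵ : Z → ℝ := fun z => wgt F γ b₀ p₀ j Ts ρ ρ' τ Φ J t Xw z with hŵ
  have hθc0 : 0 < θc := by rw [hθc]; positivity
  have hθc_le : θc ≤ θBal F.L γ b₀ p₀ j := by rw [hθc]; linarith
  have hXwj : PlaqSmall (θBal F.L γ b₀ p₀ j) Xw := fun p => lt_of_lt_of_le (hXw p) hθc_le
  -- (α) the law is a probability law with a non-negative density
  obtain ⟨_, hmass, hwi, hwn⟩ := wgt_normalised F γ b₀ p₀ j Ts hjTs ρ ρ' hρm hρ'm hρc hρ'c hρpos hθ hχc hχ0 hχsupp hχpos τ Φ J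
    hΦm hJm CJ hJle hpos t Xw hXwj
  have hwnn : ∀ z, 0 ≤ ŵ z := fun z => wgt_interp_nonneg F γ b₀ p₀ j Ts ρ ρ' hρpos hθ hχ0 hχsupp hjTs τ Φ J t Xw hmass z
  -- (β) square stability at every point of the square family, hence at the four corners, for every `z` with `mwCut (Φ (Xw, z)) ≠ 0`
  have hcorner : ∀ (X : GaugeField (F.P j) 0 ↥(Matrix.specialUnitaryGroup (Fin 2) ℂ)),
      (X = U ∨ X = V ∨ X = W ∨ X = Y) →
      ∀ z, mwCut F γ b₀ p₀ j Ts (Φ (Xw, z)) ≠ 0 → ∀ p, dist1 (GaugeField.plaqHol (Φ (X, z)) p) ≤ c * θBal F.L γ b₀ p₀ Ts := by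
    intro X hX z hz p
    have hTXw : PlaqSmall (24 / 25 * θBal F.L γ b₀ p₀ Ts) (Φ (Xw, z)) :=
      plaqSmall_top_of_mwCut_ne_zero F γ b₀ p₀ j Ts hjTs hχsupp _ hz
    -- intermediate coarse points stay in the `θ_j`-window (pen 9's margin)
    have hsqc : ∀ s ∈ Icc (0 : ℝ) 1, PlaqSmall (θBal F.L γ b₀ p₀ j) (update U B (U B * expPt (s • m))) := by
      intro s hs q
      have hsm : dist1 (expPt (s • m)) ≤ Real.sqrt 3 * (rc * θc) := by
        refine (T4ExpWindowSmallField.dist1_expPt_le_of_mem_cube ?_)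
        rw [T4CubePoincare.mem_cube_iff]
        intro i
        have h1 : |(s • m) i| ≤ ‖s • m‖ := norm_le_pi_norm (s • m) i
        have h2 : ‖s • m‖ ≤ ‖m‖ := by
          rw [norm_smul, Real.norm_eq_abs, abs_of_nonneg hs.1]
          exact mul_le_of_le_one_left (norm_nonneg _) hs.2
        exact h1.trans (h2.trans hm)
      have key := T4ExpWindowSmallField.plaqSmall_of_bdev_le hU
        (fun e => (OrganTangentSmallStepOneBond.dist1_bdev_update_le U B (expPt (s • m)) e).trans hsm) q
      refine lt_of_lt_of_le key ?_
      have : 4 * (Real.sqrt 3 * (rc * θc)) ≤ 3 * θc := by nlinarith [hθc0]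
      rw [hθc] at this ⊢; linarith
    have key := plaqSmall_chart_along_square_of_lawPoint (θc := θc) (θc' := θBal F.L γ b₀ p₀ j) hθc0 hθc_le
      (fun X => Φ (X, z)) DP (hdisp z) (hglob z) Xw hXw hTXw B B' m m' U hm hm' hU hsqc hDb0 hDb0' hDb hDb' hroom
    have h0 : (0 : ℝ) ∈ Icc (0 : ℝ) 1 := ⟨le_rfl, zero_le_one⟩
    have h1 : (1 : ℝ) ∈ Icc (0 : ℝ) 1 := ⟨zero_le_one, le_rfl⟩
    have hVeq : V = update U B (U B * expPt m) := OrganTangentSeedHClause.eq_update_of_rel hVU hVb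
    have hWeq : W = update U B' (U B' * expPt m') := OrganTangentSeedHClause.eq_update_of_rel hWU hWb
    have hYeq : Y = update (update U B (U B * expPt m)) B' ((update U B (U B * expPt m)) B' * expPt m') := by
      rw [OrganTangentSeedHClause.eq_update_of_rel hYV hYb, hVeq]
    rcases hX with rfl | rfl | rfl | rfl
    · have h := key 0 h0 0 h0 p; rw [corner_zero_zero] at h; exact h.le
    · have h := key 1 h1 0 h0 p; rw [corner_fst_zero, one_smul, ← hVeq] at h; exact h.le
    · have h := key 0 h0 1 h1 p; rw [corner_zero_snd, one_smul, ← hWeq] at h; exact h.le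
    · have h := key 1 h1 1 h1 p; rw [one_smul, one_smul, ← hYeq] at h; exact h.le
  -- the four integrabilities (LEAD №17)
  have hint : ∀ (X : GaugeField (F.P j) 0 ↥(Matrix.specialUnitaryGroup (Fin 2) ℂ)), (X = U ∨ X = V ∨ X = W ∨ X = Y) →
      Integrable (fun z => (Real.log (ρ Ts (Φ (X, z))) - Real.log (ρ' Ts (Φ (X, z)))) * wgt F γ b₀ p₀ j Ts ρ ρ' τ Φ J t Xw z) τ :=
    fun X hX => (integrable_logRatio_mul_wgt_of_squareStability F γ b₀ p₀ j Ts hjTs ρ ρ' hρm hρ'm hρc hρ'c hρpos hθ hχc hχ0 hχsupp hχpos τ Φ J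
      hΦm hJm CJ hJle hpos c hc t X Xw hXwj (hcorner X hX)).1
  refine ⟨hint U (Or.inl rfl), hint V (Or.inr (Or.inl rfl)), hint W (Or.inr (Or.inr (Or.inl rfl))), hint Y (Or.inr (Or.inr (Or.inr rfl))), ?_⟩
  -- (γ) the good-set pointwise letter from the curvature square clause (✓p814806)
  set kG : ℝ := ∑ p, ∑ q, KP p B * kP p q * KP q B' + ∑ p, gP p * KP2 p B B' with hkG
  have hkG0 : 0 ≤ kG :=
    add_nonneg (Finset.sum_nonneg fun p _ => Finset.sum_nonneg fun q _ => mul_nonneg (mul_nonneg (hKP p B) (hk p q)) (hKP q B'))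
      (Finset.sum_nonneg fun p _ => mul_nonneg (hg p) (hKP2 p B B'))
  have hsz : 0 ≤ ‖m‖ / θc := div_nonneg (norm_nonneg _) hθc0.le
  have hsz' : 0 ≤ ‖m'‖ / θc := div_nonneg (norm_nonneg _) hθc0.le
  have hG : ∀ z ∈ Good, ŵ z ≠ 0 →
      |(Real.log (ρ Ts (Φ (Y, z))) - Real.log (ρ' Ts (Φ (Y, z)))) - (Real.log (ρ Ts (Φ (V, z))) - Real.log (ρ' Ts (Φ (V, z))))
        - (Real.log (ρ Ts (Φ (W, z))) - Real.log (ρ' Ts (Φ (W, z)))) + (Real.log (ρ Ts (Φ (U, z))) - Real.log (ρ' Ts (Φ (U, z))))|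
        ≤ kG * (‖m‖ / θc) * (‖m'‖ / θc) := by
    intro z hzG hzw
    exact hClauseSq_of_curvSquare (fun X' => Real.log (ρ Ts (Φ (X', z))) - Real.log (ρ' Ts (Φ (X', z)))) kP gP KP KP2 hk hg
      (hcurv z hzG hzw) B B' m m' U V W Y hm hm' hU hV hW hY hVU hVb hWU hWb hYV hYb
  -- (ε) integrate: JT-INT
  have hI := abs_integral_secondDiff_mul_le_good_add_tail τ
    (fun z => Real.log (ρ Ts (Φ (U, z))) - Real.log (ρ' Ts (Φ (U, z))))
    (fun z => Real.log (ρ Ts (Φ (V, z))) - Real.log (ρ' Ts (Φ (V, z))))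
    (fun z => Real.log (ρ Ts (Φ (W, z))) - Real.log (ρ' Ts (Φ (W, z))))
    (fun z => Real.log (ρ Ts (Φ (Y, z))) - Real.log (ρ' Ts (Φ (Y, z))))
    ŵ Good hGood hwi hwnn hwn ES htail (kG * (‖m‖ / θc) * (‖m'‖ / θc)) (kB * (‖m‖ / θc) * (‖m'‖ / θc))
    (mul_nonneg (mul_nonneg hkG0 hsz) hsz') (mul_nonneg (mul_nonneg hkB hsz) hsz') hG (fun z hz => hcrude z hz)
  have hfin := (secondDiff_letter_bound (I := ∫ z, ((Real.log (ρ Ts (Φ (Y, z))) - Real.log (ρ' Ts (Φ (Y, z))))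
      - (Real.log (ρ Ts (Φ (V, z))) - Real.log (ρ' Ts (Φ (V, z)))) - (Real.log (ρ Ts (Φ (W, z))) - Real.log (ρ' Ts (Φ (W, z))))
      + (Real.log (ρ Ts (Φ (U, z))) - Real.log (ρ' Ts (Φ (U, z))))) * ŵ z ∂τ)
    hkG0 hkB hES (by
      have e : kG * (‖m‖ / θc) * (‖m'‖ / θc) + kB * (‖m‖ / θc) * (‖m'‖ / θc) * ES
          = kG * (‖m‖ / θc) * (‖m'‖ / θc) + (kB * (‖m‖ / θc) * (‖m'‖ / θc)) * ES := by ring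
      rw [e]; exact hI)).2
  exact hfin

end Summit.QuantumFields.YangMills.Theorems.OrganTangentJTOfCurvatureTransport

end
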